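import Summits.QuantumFields.BalabanUV.Beta.FP.StepRecursionSymEnd
import Summits.QuantumFields.BalabanUV.Beta.FP.CompositeOneShotJetDataSymG

/-!
# `BalabanUV.Beta.FP.StepRecursionSymEndG` — road «FP», S-L3b-G (wave 1, (R-b)): **THE (b) END OVER THE GRADED COMPOSITE RECORD** — S-L3b `StepRecursionSymEnd` with its jets re-based
# `JNs ↦ JNsG`, `VNs ↦ VNs (grading-blind)` (= `VNs`, `rfl`: first order is grading-blind), `WNs ↦ WNsG` (an2 L-3a `CompositeOneShotJetDataSymG` p829147 — `JNsG WNsG`, table token `tabsComp ↦ tabsCompG`; first order `VNs` is grading-blind, `vertexOfK_JNsG_S_eq_VNs` `rfl`); the corrector letters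
# `ΨL cΨL hΨdL hcΨL slotΨL cslotΨL hslotΨL hΨsL` are S-L3b's, REUSED by name; S-L3a `TowerKernelLawNamedSym` is `JN`-generic and is fed `JNsLG`
# ⇒ **`d1Tel_LG_of_hlawLG'` : pins → `hlawLG` → `D1Tel Lc (JsB12CombShSym …) (JcSymLG R P hLc N cΛ cB)`**, the graded L-composite `JcSymLG := JcSym … (JNsLG R P)`

WHY.  E-FP-73-3 (road A-12, chair XCHK-E733; E-FP-73-1∕E-AN2-94-1, referee #168 ERRATUM ACCEPTED): the by-value certificate the L END displays — SYM2 (ii) «S2 factored 1.46e−12, D₁⁺ 1.86e−12»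
(`SPAN-SYM2.addendum4.md` 56c550e9) — is for the GRADED target Nˢʸᵐ(G) (`STARTED-SYM2` 3b67f41a §Q6: `tabsCompG`∕`tad_mixG` primary; `STARTED-SYM2-FOLD` c8551995 l.3), while S-L3b's `hlawL` is typed
over the UNGRADED `WNs` (R), for which the same deposit prints «does not close in either convention (1.6e−2 ∕ B 1.82 ∕ D₁⁺ 0.13)».  THIS file types the law whose display is TRUE AS WORDED:
`hlawLG` DISPLAY RULE ((R4), as R-D1-g93-1 with the corrected attribution): (i) OPEN by name — the [K-step] law itself is the crux; (ii) ✓ by value OF RECORD at ONE lattice (2,3) FOR THESE (GRADED)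
OBJECTS: Engine C SYM2 (ii) target Nˢʸᵐ(G), S2 factored 1.46e−12, D₁⁺ 1.86e−12 (`SPAN-SYM2.addendum4.md` 56c550e9, RULING SYM2-10; float64, informational, zero weight on any binder); (iii) cite
[B12] CMP **109** (1987) p. 264 (1.20)–(1.22), printed context only (ABSOLUTE RULE).  The located sign lives in OUR composite chain rule `compMixKer`'s cross word (an2 F0
`CompositeMixedTableGraded`); whether Bałaban's own composite mixed table carries the symmetric cross pairing is not a question this tree puts.
[our object — bookkeeping] two definitions `JNsLG JcSymLG` + [folklore] lemmas (S-L3b's proofs verbatim under σ); no `def … : Prop`, nothing cited, 0 sorry; the record (ROOT M‴, (II), the L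
chain of record S-L1∕S-L3a∕S-L3b∕annex∕S-END) UNTOUCHED — a SIBLING END.  0 estimates; 0∕4 row-D1 binders (hW ∕ hR at the locks; D1Tel ∕ D1Rep AT THE RECORD OPEN); NOT (C1), NOT (L2′) at
the record, NOT (T-ID), NOT SDF, NOT D1, NEVER «G-an2-4 closed», NOT BetaPertH, NOT continuum, NOT Clay.

HONEST DEPENDENCY (page 1, mandatory): continuum YM on T⁴ ⇐ BetaPertH ∧ nine spine estimates (0/9 proved); BetaPertH ⇐ (D1) ∧ (D4) ∧ CAP+tail;
G-an2-4 gates asym, D1 and NE2/3/4.  HONEST FRAMING (cell contract, verbatim): «discharging `BetaPertH` makes Bałaban's UV stability UNCONDITIONAL —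
a real constructive-QFT result; it is NOT the continuum limit and NOT the Clay problem.»  ABSOLUTE RULE (cell charter, verbatim): «No internally-minted
statement may enter as a cited fact. Every hypothesis is either kernel-proved in this package or a verbatim quotation of a PUBLISHED theorem with page
reference. The manuscript(s) under audit are NOT citable for their own disputed steps — they are the thing under adjudication; programme-internal
(2001/route/tribunal) claims are never citable.»  Road «FP» OWNER, b2b-balaban-beta-d1-p3 gen 73, 2026-08-31 (σ of S-L3b gen 70∕71).  No existing file touched.
-/

noncomputable section

namespace Summit.QuantumFields.BalabanUV.Beta.FP.StepRecursionSymEndG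

open Literature.MathematicalPhysics.QuantumFieldTheory
open Literature.MathematicalPhysics.QuantumFieldTheory.Balaban1983to89
open Literature.MathematicalPhysics.QuantumFieldTheory.Balaban1983to89.Beta
open DressedMomentNormalisation (dressedEntry)
open ExpKernelCalculus (MKer Decays comp hessKer Zl)
open AffineAveraging (Site box toSite)
open OneStepResolventKernel (Fib KInv JetData LocStencil)
open OneStepKernelFamily (TshotOf TbalOf D1Tel vertexOfK)
open HessianTelescopingKKT (wStep)
open Summit.QuantumFields.BalabanUV.Beta.TameKernelCalculus (Spr trK)
open Summit.QuantumFields.BalabanUV.Beta.AxialDressingRooted (one_le_of_neZero coDressKBmAt spr_coDressKBmAt)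
open Summit.QuantumFields.BalabanUV.Beta.BorderedHessian (spr_KInv)
open Summit.QuantumFields.BalabanUV.Beta.SymSecondOrderTablesAn1 (symTablesAn1S2)
open Summit.QuantumFields.BalabanUV.Beta.CombChartJointEnd (JsB12CombShSym)
open Summit.QuantumFields.BalabanUV.Beta.CompositeOneShotJetData (Roots Pins JNat)
open Summit.QuantumFields.BalabanUV.Beta.CompositeCorrectorKernel (kerBound)
open Summit.QuantumFields.BalabanUV.Beta.NVertexSectorsPeriodised (locStencil_JNat_S)
open Summit.QuantumFields.BalabanUV.Beta.CompositeCorrectorKernelSym (psiKSym spr_psiKSym decays_psiKSym)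
open Summit.QuantumFields.BalabanUV.Beta.CompositeCorrectorSlotSym (slotPsiSymF locStencil_slotPsiSymF vertexOfK_conj_psiKSym)
open Summit.QuantumFields.BalabanUV.Beta.FP.CompositeOneShotJetDataSym (ANs VNs JNs_S_eq_JNat_S)
open Summit.QuantumFields.BalabanUV.Beta.FP.CompositeOneShotJetDataSymG (JNsG WNsG JNsG_S_eq_JNs_S)
open Summit.QuantumFields.BalabanUV.Beta.FP.StepRecursionSymEnd (ΨL cΨL hΨdL hcΨL slotΨL cslotΨL hslotΨL hΨsL)
open Summit.QuantumFields.BalabanUV.Beta.FP.TowerKernelLawNamedSym (VNsOf JcSym d1Tel_sym_record_JcSym_of_hlawL_pinned)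

variable {Lc : ℕ} [NeZero Lc] (R : Roots Lc) (P : Pins)

/-! ## §1 The fully-sym jets at every depth OVER THE GRADED RECORD, and the graded L-composite (S-L3b's corrector letters `ΨL cΨL hΨdL hcΨL slotΨL cslotΨL hslotΨL hΨsL` REUSED by name) -/

/-- [our object — bookkeeping] **the FULLY-SYM raw composite jets at every depth**: depth 0 = the record's `JNat R P 0`; depth `j+1` = S-L1's `JNsG R Ψ̂ˢ _ P j` (F6d-1b `JsChart0Of` over the
record's tables with the constant chart family `fun _ => ANs R Ψ̂ˢ j`). -/
def JNsLG : ∀ m : ℕ, JetData 3 (Lc ^ m)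
  | 0 => JNat R P 0
  | (j + 1) => JNsG R (ΨL R) (hΨsL R) P j

/-- the sym jets at depth `j+1` ARE S-L1's `JNs … j` (`rfl`, the defining equation). -/
theorem JNsLG_succ (j : ℕ) : JNsLG R P (j + 1) = JNsG R (ΨL R) (hΨsL R) P j := rfl

/-- the depth-`j+1` first-order stencils of the sym jets ARE the record's (chart-free at storey 0; an2 L-3a `JNsG_S_eq_JNs_S` ∘ S-L1 `JNs_S_eq_JNat_S`). -/
theorem JNsLG_S (j : ℕ) : (JNsLG R P (j + 1)).S = (JNat R P (j + 1)).S := by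
  rw [JNsLG_succ]; exact (JNsG_S_eq_JNs_S R (ΨL R) (hΨsL R) P j).trans (JNs_S_eq_JNat_S R (ΨL R) (hΨsL R) P j)

variable (hLc : Odd Lc) (N : ℕ) (cΛ cB : ℝ)

/-- [our object — bookkeeping] **the L-composite one-shot jets** `JcSym` AT `Ψ̂ˢ` with every parameter fed by name. -/
def JcSymLG : ∀ m : ℕ, JetData 3 (Lc ^ m) :=
  JcSym hLc N cΛ cB R (ΨL R) (cΨL R) (hΨdL R) (hcΨL R) (slotΨL R) (cslotΨL R) (hslotΨL R) (JNsLG R P)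

/-! ## §2 The slot ADJUNCTION `hadj` DISCHARGED (F-L5 `vertexOfK_conj_psiKSym` over the record's stencil locality `locStencil_JNat_S`) -/

/-- `hadj` at `Ψ̂ˢ` and the sym jets: a THEOREM. -/
theorem hadjLG : ∀ (m : ℕ) (μ : Fin (3 + 1)) (y : Site (3 + 1)),
    vertexOfK (ANs R (ΨL R) (m + 1)) (Lc ^ (m + 2)) (JNsLG R P (m + 2)).S μ y
      = vertexOfK (coDressKBmAt (toSite (R.s (m + 2))) (Lc ^ (m + 2)) (KInv (N := Lc ^ (m + 2)) (d := 3))) (Lc ^ (m + 2)) (slotΨL R (m + 2) (JNsLG R P (m + 2)).S) μ y := by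
  intro m μ y
  obtain ⟨Cs, δs, hδs, hS⟩ := locStencil_JNat_S R P (m + 1)
  rw [JNsLG_S]
  exact vertexOfK_conj_psiKSym (Nat.pos_of_ne_zero (NeZero.ne Lc)) R.hrc (m + 2)
    (spr_coDressKBmAt (one_le_of_neZero (Lc ^ (m + 2))) (R.hs (m + 2)) spr_KInv) hS hδs μ y

/-! ## §3 THE (b) END: `D1Tel` at ROOT M‴'s literal and `JcSymLG` from the pins and `hlawLG` ALONE -/

/-- [folklore] **`d1Tel_LG_of_hlawLG` — OPTION (b)'s END WITH ONE DISPLAYED HYPOTHESIS OF CONTENT.** S-L3a `d1Tel_sym_record_JcSym_of_hlawL_pinned` fed, by name: `hΨs := spr_psiKSym`,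
`JcSym`'s parameters := `decays_psiKSym`∕`slotPsiSymF`∕`locStencil_slotPsiSymF`, `JN := JNsL` (fully sym), `hadj := hadjL`. What remains displayed: the record's pins and `hlawLG`
(the [K-step] law on the L-chart — ✓ by value OF RECORD at (2,3), SYM2 (ii); a HYPOTHESIS by name).  `hlawLG` DISPLAY RULE (R-D1-g93-1 (R4)): (i) OPEN by name — the [K-step] law itself is the crux; (ii) ✓ by value OF RECORD at ONE lattice (2,3), float64 (S2 factored 1.46e−12, D₁⁺ 1.86e−12; `SPAN-SYM2.addendum4.md` 56c550e9, RULING SYM2-10; informational, zero weight); (iii) cite [B12] CMP 109 (1987) p. 264 (1.20)–(1.22), printed context only (ABSOLUTE RULE). -/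
theorem d1Tel_LG_of_hlawLG (hL2 : 2 ≤ Lc) (hN2 : 2 ≤ N) (hΛ : cΛ * (Lc : ℝ) ^ 4 = 2) (hcB : cB = -((Lc : ℝ) ^ 12 / 4))
    (hlawLG : ∀ j : ℕ, 1 ≤ j → ∀ (a b : Fin 4) (z : Fin 4 → ℤ),
      hessKer (ANs R (ΨL R) j) (VNsOf R (ΨL R) (JNsLG R P) j) (JNsLG R P (j + 1)).W a b z =
        (Lc : ℝ) ^ 8 * dressedEntry (wStep Lc j) (TshotOf Lc (JcSymLG R P hLc N cΛ cB) j) ((Lc : ℤ) • z) a b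
          + TbalOf Lc (JsB12CombShSym hLc N (symTablesAn1S2 3 Lc cΛ) cΛ cB) j a b z) :
    D1Tel Lc (JsB12CombShSym hLc N (symTablesAn1S2 3 Lc cΛ) cΛ cB) (JcSymLG R P hLc N cΛ cB) :=
  d1Tel_sym_record_JcSym_of_hlawL_pinned hLc N cΛ cB R (ΨL R) (cΨL R) (hΨdL R) (hcΨL R) (slotΨL R) (cslotΨL R) (hslotΨL R) (JNsLG R P)
    hL2 hN2 hΛ hcB (hΨsL R) (hadjLG R P) hlawLG

/-! ## §4 `rfl` BRIDGES to S-L1's families, and the END with `hlawLG` stated over `ANs ∕ VNs ∕ WNs` -/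

/-- the END's first-order family IS S-L1's `VNs` at `Ψ̂ˢ` (`rfl`). -/
theorem VNsOf_eq_VNs_G (j : ℕ) : VNsOf R (ΨL R) (JNsLG R P) j = VNs R (ΨL R) (hΨsL R) P j := rfl

/-- the END's second-order family IS S-L1's `WNs` at `Ψ̂ˢ` (`rfl`). -/
theorem JNsLG_W_eq_WNsG (j : ℕ) : (JNsLG R P (j + 1)).W = WNsG R (ΨL R) (hΨsL R) P j := rfl

/-- [folklore] **OPTION (b)'s END, `hlawLG` IN S-L1's VOCABULARY**: the [K-step] law stated on `hessKer (ANs R Ψ̂ˢ j) (VNs R Ψ̂ˢ _ P j) (WNsG R Ψ̂ˢ _ P j)` — the object SYM2 (ii) certified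
by value at (2,3) — gives `D1Tel`.  `hlawLG` DISPLAY RULE (R-D1-g93-1 (R4)): (i) OPEN by name — the [K-step] law itself is the crux; (ii) ✓ by value OF RECORD at ONE lattice (2,3), float64 (S2 factored 1.46e−12, D₁⁺ 1.86e−12; `SPAN-SYM2.addendum4.md` 56c550e9, RULING SYM2-10; informational, zero weight); (iii) cite [B12] CMP 109 (1987) p. 264 (1.20)–(1.22), printed context only (ABSOLUTE RULE). -/
theorem d1Tel_LG_of_hlawLG' (hL2 : 2 ≤ Lc) (hN2 : 2 ≤ N) (hΛ : cΛ * (Lc : ℝ) ^ 4 = 2) (hcB : cB = -((Lc : ℝ) ^ 12 / 4))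
    (hlawLG : ∀ j : ℕ, 1 ≤ j → ∀ (a b : Fin 4) (z : Fin 4 → ℤ),
      hessKer (ANs R (ΨL R) j) (VNs R (ΨL R) (hΨsL R) P j) (WNsG R (ΨL R) (hΨsL R) P j) a b z =
        (Lc : ℝ) ^ 8 * dressedEntry (wStep Lc j) (TshotOf Lc (JcSymLG R P hLc N cΛ cB) j) ((Lc : ℤ) • z) a b
          + TbalOf Lc (JsB12CombShSym hLc N (symTablesAn1S2 3 Lc cΛ) cΛ cB) j a b z) :
    D1Tel Lc (JsB12CombShSym hLc N (symTablesAn1S2 3 Lc cΛ) cΛ cB) (JcSymLG R P hLc N cΛ cB) :=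
  d1Tel_LG_of_hlawLG R P hLc N cΛ cB hL2 hN2 hΛ hcB fun j hj a b z => hlawLG j hj a b z

end Summit.QuantumFields.BalabanUV.Beta.FP.StepRecursionSymEndG

end
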